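import Mathlib.MeasureTheory.Integral.Marginal
import Literature.MathematicalPhysics.KineticTheory.InfiniteChainGibbsMomenta
import HarnessLib

/-!
# The Markov kernel of the transfer operator of the chain: normalisation and the one-site peel

Topic `Literature/MathematicalPhysics/KineticTheory`; theorems only (no definitions, no named
facts). For the oscillator chain `P : OscillatorChain` at temperature `T > 0` and transfer
eigen-data `(λ, ψ)` — `λ > 0`, `ψ > 0`, and the eigen-equation
`∫ e^{-U(q')/T} (e^{-V(q'-q)/T} ψ(q')) dq' = λ ψ(q)` (existence:
`InfiniteChainTransferOperator.exists_transferEigenfunction`; taken here as HYPOTHESES) — the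
stationary two-sided Markov chain of Cassandro–Olivieri–Pellegrinotti–Presutti (1978), §2, has the
one-step transition weight (density of site `x + 1` given site `x`, w.r.t. Lebesgue on `ℝ × ℝ`)
`τ(q; q', p') = λ⁻¹ ψ(q)⁻¹ e^{-U(q')/T} e^{-V(q'-q)/T} ψ(q') · (2πT)^{-1/2} e^{-p'²/(2T)}`.

* `lintegral_transitionWeight_eq_one` — **`τ(q; ·)` is a probability density** for every `q` with
  `ψ(q) > 0` (eigen-equation in `q'`, Gaussian mass one in `p'`; Tonelli on `ℝ × ℝ`);
* `lmarginal_singleton_mul_transitionWeight` — **the one-site peel**: for an observable `F ≥ 0` of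
  the configuration not reading site `x + 1`,
  `(∫⋯∫⁻_{ {x+1} } F(σ) τ(q_x; σ_{x+1}))(σ) = F(σ)` (Mathlib `lmarginal_singleton`). Integrating
  out the last site of a window against the transition weight is the identity: this is the
  consistency `∫ ρ_{a,b+1} d(site b+1) = ρ_{a,b}` of the window densities
  `ρ_{a,b} = ψ(q_a) ψ(q_b) λ^{-(b-a)} ∏ sites ∏ bonds` of the stationary chain, and the
  computation behind its DLR equations.

## References

* M. Cassandro, E. Olivieri, A. Pellegrinotti, E. Presutti, Z. Wahrsch. verw. Gebiete 41 (1978)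
  313–334, §2.
* H.-O. Georgii, *Gibbs Measures and Phase Transitions* (2011), §3.1 and Thm 3.5 (one-dimensional
  Markov chains as Gibbs measures of nearest-neighbour potentials). [Georgii2011]
-/

noncomputable section

open MeasureTheory Filter Set Function
open scoped ENNReal

namespace Literature.MathematicalPhysics.KineticTheory.HeatConduction

namespace OscillatorChain

variable (P : OscillatorChain)

/-! ### The normalised Markov transition weight -/

/-- **The transition weight of the transfer-operator Markov chain integrates to one.** If
`∫ e^{-U(q')/T} (e^{-V(q'-q)/T} ψ(q')) dq' = λ ψ(q)` with `λ > 0`, `ψ ≥ 0`, `ψ(q) > 0`, the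
integrand being integrable, and `T > 0`, then
`∫⁻_{ℝ×ℝ} λ⁻¹ ψ(q)⁻¹ e^{-U(q')/T} e^{-V(q'-q)/T} ψ(q') · (2πT)^{-1/2} e^{-p'²/(2T)} d(q', p') = 1`
(Tonelli on `ℝ × ℝ`; the Gaussian momentum factor has mass one, `lintegral_gaussWeight`)
(Cassandro–Olivieri–Pellegrinotti–Presutti 1978, §2, the stochastic kernel of the transfer
operator; Georgii 2011, §3.1). [cite: Georgii2011, §3.1] -/
theorem lintegral_transitionWeight_eq_one {T : ℝ} (hT : 0 < T) {lam : ℝ} (hlam : 0 < lam)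
    {ψ : ℝ → ℝ} (hψ0 : ∀ q, 0 ≤ ψ q) {q : ℝ} (hψq : 0 < ψ q)
    (hint : Integrable fun q' => Real.exp (-T⁻¹ * P.U q') *
      (Real.exp (-T⁻¹ * P.V (q' - q)) * ψ q'))
    (heig : ∫ q', Real.exp (-T⁻¹ * P.U q') * (Real.exp (-T⁻¹ * P.V (q' - q)) * ψ q') =
      lam * ψ q) :
    ∫⁻ z : ℝ × ℝ, ENNReal.ofReal (lam⁻¹ * (ψ q)⁻¹ *
        (Real.exp (-T⁻¹ * P.U z.1) * (Real.exp (-T⁻¹ * P.V (z.1 - q)) * ψ z.1))) *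
      ENNReal.ofReal ((Real.sqrt (2 * Real.pi * T))⁻¹ * Real.exp (-z.2 ^ 2 / (2 * T))) = 1 := by
  -- Tonelli
  have hf : AEMeasurable (fun q' : ℝ => ENNReal.ofReal (lam⁻¹ * (ψ q)⁻¹ *
      (Real.exp (-T⁻¹ * P.U q') * (Real.exp (-T⁻¹ * P.V (q' - q)) * ψ q')))) volume :=
    ENNReal.measurable_ofReal.comp_aemeasurable (hint.aestronglyMeasurable.aemeasurable.const_mul _)
  have hg : AEMeasurable (fun p : ℝ => ENNReal.ofReal ((Real.sqrt (2 * Real.pi * T))⁻¹ *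
      Real.exp (-p ^ 2 / (2 * T)))) volume :=
    (ENNReal.measurable_ofReal.comp (by fun_prop)).aemeasurable
  rw [Measure.volume_eq_prod, lintegral_prod_mul hf hg]
  -- the position factor: the eigen-equation
  have hpos : ∫⁻ q', ENNReal.ofReal (lam⁻¹ * (ψ q)⁻¹ *
      (Real.exp (-T⁻¹ * P.U q') * (Real.exp (-T⁻¹ * P.V (q' - q)) * ψ q'))) = 1 := by
    have hnn : 0 ≤ᵐ[volume] fun q' => lam⁻¹ * (ψ q)⁻¹ *
        (Real.exp (-T⁻¹ * P.U q') * (Real.exp (-T⁻¹ * P.V (q' - q)) * ψ q')) :=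
      Eventually.of_forall fun q' => by
        have := hψ0 q'
        positivity
    rw [← ofReal_integral_eq_lintegral_ofReal (hint.const_mul _) hnn, integral_const_mul, heig,
      ← ENNReal.ofReal_one]
    congr 1
    field_simp
  -- the momentum factor: Gaussian mass one
  have hmom : ∫⁻ p, ENNReal.ofReal ((Real.sqrt (2 * Real.pi * T))⁻¹ *
      Real.exp (-p ^ 2 / (2 * T))) = 1 := by
    have hs : 0 < Real.sqrt (2 * Real.pi * T) := Real.sqrt_pos.2 (by positivity)
    have h1 : ∀ p, ENNReal.ofReal ((Real.sqrt (2 * Real.pi * T))⁻¹ * Real.exp (-p ^ 2 / (2 * T))) =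
        ENNReal.ofReal ((Real.sqrt (2 * Real.pi * T))⁻¹) * gaussWeight T p := fun p => by
      rw [gaussWeight, ← ENNReal.ofReal_mul (inv_nonneg.2 hs.le)]
    simp_rw [h1]
    rw [lintegral_const_mul _ (measurable_gaussWeight T), lintegral_gaussWeight hT,
      ← ENNReal.ofReal_mul (inv_nonneg.2 hs.le), inv_mul_cancel₀ hs.ne', ENNReal.ofReal_one]
  rw [hpos, hmom, one_mul]

/-! ### The one-site peel -/

/-- The transition weight `τ(q_x; q_{x+1}, p_{x+1})` read on the configuration is measurable
(`U`, `V`, `ψ` measurable). [folklore] -/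
theorem measurable_transitionWeight (hU : Measurable P.U) (hV : Measurable P.V) (T lam : ℝ)
    {ψ : ℝ → ℝ} (hψm : Measurable ψ) (x : ℤ) :
    Measurable fun σ : ChainConfig =>
      ENNReal.ofReal (lam⁻¹ * (ψ (σ x).1)⁻¹ *
          (Real.exp (-T⁻¹ * P.U (σ (x + 1)).1) *
            (Real.exp (-T⁻¹ * P.V ((σ (x + 1)).1 - (σ x).1)) * ψ (σ (x + 1)).1))) *
        ENNReal.ofReal ((Real.sqrt (2 * Real.pi * T))⁻¹ *
          Real.exp (-(σ (x + 1)).2 ^ 2 / (2 * T))) := by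
  have hq : ∀ i : ℤ, Measurable fun σ : ChainConfig => (σ i).1 := fun i =>
    measurable_fst.comp (measurable_pi_apply i)
  have hp : ∀ i : ℤ, Measurable fun σ : ChainConfig => (σ i).2 := fun i =>
    measurable_snd.comp (measurable_pi_apply i)
  refine (ENNReal.measurable_ofReal.comp ?_).mul (ENNReal.measurable_ofReal.comp ?_)
  · exact ((measurable_const.mul (hψm.comp (hq x)).inv).mul
      ((Real.measurable_exp.comp ((hU.comp (hq (x + 1))).const_mul _)).mul
        ((Real.measurable_exp.comp ((hV.comp ((hq (x + 1)).sub (hq x))).const_mul _)).mul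
          (hψm.comp (hq (x + 1))))))
  · exact measurable_const.mul (Real.measurable_exp.comp
      ((((hp (x + 1)).pow_const 2).neg.div_const _)))

/-- **The one-site peel of the stationary transfer-operator chain.** Let `(λ, ψ)` be transfer
eigen-data at `T > 0` (`λ > 0`, `ψ > 0` measurable, eigen-equation with integrable integrand at
every `q`), `U`, `V` measurable. For every observable `F ≥ 0` of the configuration that does not
read site `x + 1`, integrating out site `x + 1` against the transition weight
`τ(q_x; q_{x+1}, p_{x+1})` returns `F`:
`(∫⋯∫⁻_{ {x+1} }, F · τ(q_x; σ_{x+1}))(σ) = F(σ)` (Mathlib `lmarginal_singleton`, the frozen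
site `x` is untouched by the update at `x + 1`, and `lintegral_transitionWeight_eq_one`). This is
the consistency step `∫ ρ_{a,b+1} d(q_{b+1}, p_{b+1}) = ρ_{a,b}` for the window densities of the
chain (Cassandro–Olivieri–Pellegrinotti–Presutti 1978, §2; Georgii 2011, §3.1).
[cite: Georgii2011, §3.1] -/
theorem lmarginal_singleton_mul_transitionWeight (hU : Measurable P.U) (hV : Measurable P.V)
    {T : ℝ} (hT : 0 < T) {lam : ℝ} (hlam : 0 < lam) {ψ : ℝ → ℝ} (hψm : Measurable ψ)
    (hψ : ∀ q, 0 < ψ q)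
    (hint : ∀ q, Integrable fun q' => Real.exp (-T⁻¹ * P.U q') *
      (Real.exp (-T⁻¹ * P.V (q' - q)) * ψ q'))
    (heig : ∀ q, ∫ q', Real.exp (-T⁻¹ * P.U q') * (Real.exp (-T⁻¹ * P.V (q' - q)) * ψ q') =
      lam * ψ q)
    (x : ℤ) {F : ChainConfig → ℝ≥0∞} (hF : DependsOn F ({x + 1}ᶜ : Set ℤ)) (σ : ChainConfig) :
    (∫⋯∫⁻_{x + 1}, (fun σ : ChainConfig => F σ *
        (ENNReal.ofReal (lam⁻¹ * (ψ (σ x).1)⁻¹ *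
          (Real.exp (-T⁻¹ * P.U (σ (x + 1)).1) *
            (Real.exp (-T⁻¹ * P.V ((σ (x + 1)).1 - (σ x).1)) * ψ (σ (x + 1)).1))) *
        ENNReal.ofReal ((Real.sqrt (2 * Real.pi * T))⁻¹ *
          Real.exp (-(σ (x + 1)).2 ^ 2 / (2 * T)))))
      ∂fun _ : ℤ => (volume : Measure (ℝ × ℝ))) σ = F σ := by
  rw [lmarginal_singleton]
  have hx : ∀ z : ℝ × ℝ, Function.update σ (x + 1) z x = σ x := fun z => by
    rw [Function.update_of_ne (show x ≠ x + 1 by omega)]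
  have hFz : ∀ z : ℝ × ℝ, F (Function.update σ (x + 1) z) = F σ := fun z =>
    hF fun i hi => by
      rw [Function.update_of_ne (show i ≠ x + 1 by simpa using hi)]
  simp only [Function.update_self, hx, hFz]
  have hmeas : Measurable fun z : ℝ × ℝ =>
      ENNReal.ofReal (lam⁻¹ * (ψ (σ x).1)⁻¹ *
          (Real.exp (-T⁻¹ * P.U z.1) * (Real.exp (-T⁻¹ * P.V (z.1 - (σ x).1)) * ψ z.1))) *
        ENNReal.ofReal ((Real.sqrt (2 * Real.pi * T))⁻¹ * Real.exp (-z.2 ^ 2 / (2 * T))) := by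
    refine (ENNReal.measurable_ofReal.comp ?_).mul (ENNReal.measurable_ofReal.comp ?_)
    · exact measurable_const.mul ((Real.measurable_exp.comp ((hU.comp measurable_fst).const_mul _)).mul
        ((Real.measurable_exp.comp ((hV.comp (measurable_fst.sub measurable_const)).const_mul _)).mul
          (hψm.comp measurable_fst)))
    · exact measurable_const.mul (Real.measurable_exp.comp
        (((measurable_snd.pow_const 2).neg.div_const _)))
  rw [lintegral_const_mul _ hmeas, P.lintegral_transitionWeight_eq_one hT hlam
    (fun q => (hψ q).le) (hψ _) (hint _) (heig _), mul_one]

end OscillatorChain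

end Literature.MathematicalPhysics.KineticTheory.HeatConduction
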